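import Mathlib
import Summits.ValiantsHypothesis.ValiantsHypothesis.Theorems.GeneratorObstructionsPowGenDegreeQPBlockCountGen

/-!
# Route GeneratorObstructions — crux K2 `PowGenDegreeQP` (stmt-ValiantsHypothesis-11655), line
# `trace-side-regimes`: evaluation of the block signed count — `(-1)^k C(3k,k) C(2k,k) · E(k)`

Companion of `…PowGenDegreeQPBlockCountGen` (the design `D*`, `blockSum`, the generating identity
`coeff_blockGen`, `blockGen_eq : blockGen = det^{3k} (Δ₀₁Δ₀₂Δ₁₂)^k`) and `…PowGenDegreeQPDixonParity`.
Here the coefficient is evaluated: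

* `coeff_delta_prod_pow` — the coefficient of `∏_ℓ x_{ℓ,A'}^{2k} x_{ℓ,A}^{2k}` in `(Δ₀₁ Δ₀₂ Δ₁₂)^{2k}` is
  the Dixon sum `E(k) = Σ_a (-1)^a C(2k,a)^3` (three binomial expansions; the exponent bookkeeping
  forces `b = 2k - a`, `c = a`);
* `coeff_blockTgt_detPow_mul` — cofactor expansion of `det` along the `B` column and the trinomial
  theorem: only the term `(k,k,k)` meets the target, with multinomial `C(3k,k) C(2k,k)`;
* `blockSum_eq` — **`blockSum k = (-1)^k · C(3k,k) C(2k,k) · E(k)`**;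
* `blockSum_two_pow_ne_zero` — hence `blockSum (2^t) ≠ 0` (`dixonSum_two_pow_ne_zero`).  (By Dixon's
  identity `E(k) = (-1)^k (3k)!/(k!)^3` the count is `((3k)!/(k!)^3)^2 > 0` for every `k`; brute force
  `k ≤ 6` agrees; not needed.)

This is the per-block factor of the value of the blueprint's tableau highest-weight vector at the
canonical doubling gadget (evidence memo `evidence-11655-leafhand3-g5.md`); with the type-preservation
factorisation (next file to write) it discharges the hypothesis of
`not_powGenDegreeQP_of_canonicalGadgetGIT_pow`.  Honest framing: a finite identity; no stub, crux or
summit is settled here; `VP ≠ VNP` untouched. [folklore]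
-/

namespace Summit.ValiantsHypothesis.ValiantsHypothesis.Theorems.GeneratorObstructions.PowGenDegreeQP

-- `Summit.ValiantsHypothesis.ValiantsHypothesis.…` is the tree's mandated single-conjunct layout.
set_option linter.dupNamespace false

open MvPolynomial Finset

noncomputable section

/-! ## §4 Evaluation of the coefficient: cofactor expansion, trinomial and binomial theorems -/

/-- Unit exponent vectors `s(ℓ,r)`. [folklore] -/
abbrev sx (ℓ r : Fin 3) : (Fin 3 × Fin 3) →₀ ℕ := Finsupp.single (ℓ, r) 1

/-- The `A'/A` part of the target: every label gets `2k` letters `A'` and `2k` letters `A`. [folklore] -/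
def blockTgt' (k : ℕ) : (Fin 3 × Fin 3) →₀ ℕ :=
  ∑ ℓ : Fin 3, (Finsupp.single (ℓ, 0) (2 * k) + Finsupp.single (ℓ, 1) (2 * k))

/-- The `B` part of the target: every label gets `k` letters `B`. [folklore] -/
def blockTgtB (k : ℕ) : (Fin 3 × Fin 3) →₀ ℕ := ∑ ℓ : Fin 3, Finsupp.single (ℓ, 2) k

/-- `blockTgt = blockTgt' + blockTgtB`. [folklore] -/
theorem blockTgt_eq (k : ℕ) : blockTgt k = blockTgt' k + blockTgtB k := by
  simp only [blockTgt, blockTgt', blockTgtB, ← Finset.sum_add_distrib]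

/-- The value of `blockTgt k` at a `B`-letter coordinate is `k`. [folklore] -/
theorem blockTgt_apply_two (k : ℕ) (ℓ : Fin 3) : blockTgt k (ℓ, 2) = k := by
  simp only [blockTgt, Finsupp.coe_add, Pi.add_apply, Finsupp.single_apply, Prod.mk.injEq,
    Fin.sum_univ_three]
  fin_cases ℓ <;> simp

/-- A minor as a difference of two monomials. [folklore] -/
theorem delta_eq_monomial (p q : Fin 3) :
    delta p q = monomial (sx p 0 + sx q 1) 1 - monomial (sx p 1 + sx q 0) 1 := by
  simp only [delta, sx, X, monomial_mul, mul_one]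

/-- Binomial theorem for a difference of two monic monomials (over `ℤ`):
`(x^s - x^{s'})^n = Σ_a C(n,a) (-1)^{n-a} x^{a s + (n-a) s'}`. [folklore] -/
theorem sub_monomial_pow {ι : Type*} (s s' : ι →₀ ℕ) (n : ℕ) :
    (monomial s (1 : ℤ) - monomial s' 1) ^ n =
      ∑ a ∈ Finset.range (n + 1),
        monomial (a • s + (n - a) • s') ((-1) ^ (n - a) * (n.choose a : ℤ)) := by
  rw [sub_eq_add_neg, add_pow]
  refine Finset.sum_congr rfl fun a _ => ?_
  rw [neg_pow, monomial_pow, monomial_pow, one_pow, one_pow,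
    show ((-1 : MvPolynomial ι ℤ)) ^ (n - a) = C ((-1 : ℤ) ^ (n - a)) by simp,
    show ((n.choose a : ℕ) : MvPolynomial ι ℤ) = C ((n.choose a : ℕ) : ℤ) by simp,
    C_mul_monomial, monomial_mul]
  rw [mul_comm (monomial (a • s + (n - a) • s') _) (C _), C_mul_monomial]
  congr 1
  ring

/-- Exponent vector of the `a`-th term of `Δ₀₁^{2k}`. [folklore] -/
def e01 (k a : ℕ) : (Fin 3 × Fin 3) →₀ ℕ := a • (sx 0 0 + sx 1 1) + (2 * k - a) • (sx 0 1 + sx 1 0)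
/-- Exponent vector of the `b`-th term of `Δ₀₂^{2k}`. [folklore] -/
def e02 (k b : ℕ) : (Fin 3 × Fin 3) →₀ ℕ := b • (sx 0 0 + sx 2 1) + (2 * k - b) • (sx 0 1 + sx 2 0)
/-- Exponent vector of the `c`-th term of `Δ₁₂^{2k}`. [folklore] -/
def e12 (k c : ℕ) : (Fin 3 × Fin 3) →₀ ℕ := c • (sx 1 0 + sx 2 1) + (2 * k - c) • (sx 1 1 + sx 2 0)

/-- Coefficient of the `a`-th binomial term. [folklore] -/
def bc (k a : ℕ) : ℤ := (-1) ^ (2 * k - a) * ((2 * k).choose a : ℤ)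

/-- Binomial expansion of `Δ₀₁^{2k}`. [folklore] -/
theorem delta01_pow (k : ℕ) :
    delta 0 1 ^ (2 * k) = ∑ a ∈ Finset.range (2 * k + 1), monomial (e01 k a) (bc k a) := by
  rw [delta_eq_monomial, sub_monomial_pow]; rfl

/-- Binomial expansion of `Δ₀₂^{2k}`. [folklore] -/
theorem delta02_pow (k : ℕ) :
    delta 0 2 ^ (2 * k) = ∑ a ∈ Finset.range (2 * k + 1), monomial (e02 k a) (bc k a) := by
  rw [delta_eq_monomial, sub_monomial_pow]; rfl

/-- Binomial expansion of `Δ₁₂^{2k}`. [folklore] -/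
theorem delta12_pow (k : ℕ) :
    delta 1 2 ^ (2 * k) = ∑ a ∈ Finset.range (2 * k + 1), monomial (e12 k a) (bc k a) := by
  rw [delta_eq_monomial, sub_monomial_pow]; rfl

/-- Coordinates of the exponent vector `e01 a + e02 b + e12 c`. [folklore] -/
theorem e_apply (k a b c : ℕ) (ℓ r : Fin 3) :
    (e01 k a + e02 k b + e12 k c) (ℓ, r) =
      (if (ℓ, r) = ((0 : Fin 3), (0 : Fin 3)) then a + b else 0) +
      (if (ℓ, r) = ((0 : Fin 3), (1 : Fin 3)) then (2 * k - a) + (2 * k - b) else 0) +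
      (if (ℓ, r) = ((1 : Fin 3), (0 : Fin 3)) then (2 * k - a) + c else 0) +
      (if (ℓ, r) = ((1 : Fin 3), (1 : Fin 3)) then a + (2 * k - c) else 0) +
      (if (ℓ, r) = ((2 : Fin 3), (0 : Fin 3)) then (2 * k - b) + (2 * k - c) else 0) +
      (if (ℓ, r) = ((2 : Fin 3), (1 : Fin 3)) then b + c else 0) := by
  simp only [e01, e02, e12, sx, Finsupp.coe_add, Finsupp.coe_smul, Pi.add_apply, Pi.smul_apply,
    Finsupp.single_apply, Prod.mk.injEq, smul_eq_mul]
  fin_cases ℓ <;> fin_cases r <;> simp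

/-- Coordinates of `blockTgt' k`. [folklore] -/
theorem blockTgt'_apply (k : ℕ) (ℓ r : Fin 3) :
    blockTgt' k (ℓ, r) = if r = 2 then 0 else 2 * k := by
  simp only [blockTgt', Finsupp.coe_add, Pi.add_apply, Finsupp.single_apply, Prod.mk.injEq,
    Fin.sum_univ_three]
  fin_cases ℓ <;> fin_cases r <;> simp

/-- The exponent vectors hitting the target: `b = 2k - a`, `c = a`. [folklore] -/
theorem e_eq_blockTgt'_iff {k a b c : ℕ} (ha : a ≤ 2 * k) (hb : b ≤ 2 * k) (hc : c ≤ 2 * k) :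
    e01 k a + e02 k b + e12 k c = blockTgt' k ↔ b = 2 * k - a ∧ c = a := by
  constructor
  · intro h
    have h00 := congrArg (fun f => f ((0 : Fin 3), (0 : Fin 3))) h
    have h10 := congrArg (fun f => f ((1 : Fin 3), (0 : Fin 3))) h
    simp only [e_apply, blockTgt'_apply] at h00 h10
    simp at h00 h10
    omega
  · rintro ⟨rfl, rfl⟩
    ext ⟨ℓ, r⟩
    rw [e_apply, blockTgt'_apply]
    fin_cases ℓ <;> fin_cases r <;> simp <;> omega

/-- **The binomial heart**: the coefficient of `∏_ℓ x_{ℓ,A'}^{2k} x_{ℓ,A}^{2k}` in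
`(Δ₀₁ Δ₀₂ Δ₁₂)^{2k}` is the Dixon sum `Σ_a (-1)^a C(2k,a)^3`. [folklore] -/
theorem coeff_delta_prod_pow (k : ℕ) :
    coeff (blockTgt' k) (delta 0 1 ^ (2 * k) * delta 0 2 ^ (2 * k) * delta 1 2 ^ (2 * k)) =
      ∑ a ∈ Finset.range (2 * k + 1), (-1 : ℤ) ^ a * ((2 * k).choose a : ℤ) ^ 3 := by
  rw [delta01_pow, delta02_pow, delta12_pow, Finset.sum_mul_sum, Finset.sum_mul_sum, coeff_sum]
  refine Finset.sum_congr rfl fun a ha => ?_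
  rw [Finset.mem_range] at ha
  -- the term for fixed `a` is `Σ_c (Σ_b A_a B_b) C_c`
  have hterm : ∀ b ∈ Finset.range (2 * k + 1), ∀ c ∈ Finset.range (2 * k + 1),
      coeff (blockTgt' k) (monomial (e01 k a) (bc k a) * monomial (e02 k b) (bc k b) *
        monomial (e12 k c) (bc k c)) =
        if b = 2 * k - a ∧ c = a then bc k a * bc k b * bc k c else 0 := by
    intro b hb c hc
    rw [Finset.mem_range] at hb hc
    rw [monomial_mul, monomial_mul, coeff_monomial]
    by_cases h : b = 2 * k - a ∧ c = a
    · rw [if_pos h, if_pos ((e_eq_blockTgt'_iff (by omega) (by omega) (by omega)).mpr h)]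
    · rw [if_neg h, if_neg (fun h' => h ((e_eq_blockTgt'_iff (by omega) (by omega) (by omega)).mp h'))]
  rw [coeff_sum]
  have step : ∀ c ∈ Finset.range (2 * k + 1),
      coeff (blockTgt' k) ((∑ b ∈ Finset.range (2 * k + 1),
        monomial (e01 k a) (bc k a) * monomial (e02 k b) (bc k b)) * monomial (e12 k c) (bc k c)) =
        ∑ b ∈ Finset.range (2 * k + 1),
          if b = 2 * k - a ∧ c = a then bc k a * bc k b * bc k c else 0 := by
    intro c hc
    rw [Finset.sum_mul, coeff_sum]
    exact Finset.sum_congr rfl fun b hb => hterm b hb c hc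
  rw [Finset.sum_congr rfl step]
  -- collapse: first the inner sum over `b`, then the sum over `c`
  have hcol : ∀ c ∈ Finset.range (2 * k + 1),
      (∑ b ∈ Finset.range (2 * k + 1), if b = 2 * k - a ∧ c = a then bc k a * bc k b * bc k c else 0) =
        if c = a then bc k a * bc k (2 * k - a) * bc k c else 0 := by
    intro c hc
    by_cases hca : c = a
    · simp only [hca, and_true, if_true]
      rw [Finset.sum_ite_eq' (Finset.range (2 * k + 1)) (2 * k - a),
        if_pos (Finset.mem_range.mpr (by omega))]
    · simp [hca]
  rw [Finset.sum_congr rfl hcol, Finset.sum_ite_eq' (Finset.range (2 * k + 1)) a,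
    if_pos (Finset.mem_range.mpr ha)]
  -- the arithmetic of the surviving term
  simp only [bc]
  rw [show 2 * k - (2 * k - a) = a by omega, Nat.choose_symm (by omega : a ≤ 2 * k)]
  have hsign : ((-1 : ℤ)) ^ (2 * k - a) = (-1) ^ a := by
    have : ((-1 : ℤ)) ^ (2 * k - a) * (-1) ^ a = 1 := by
      rw [← pow_add, show 2 * k - a + a = 2 * k by omega, pow_mul]; simp
    have hsq : ((-1 : ℤ) ^ a) * (-1) ^ a = 1 := by rw [← pow_add, ← two_mul, pow_mul]; simp
    calc ((-1 : ℤ)) ^ (2 * k - a) = (-1) ^ (2 * k - a) * ((-1) ^ a * (-1) ^ a) := by rw [hsq, mul_one]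
      _ = ((-1) ^ (2 * k - a) * (-1) ^ a) * (-1) ^ a := by ring
      _ = (-1) ^ a := by rw [this, one_mul]
  rw [hsign]
  have hcube : ((-1 : ℤ) ^ a) ^ 3 = (-1) ^ a := by
    rw [← pow_mul, mul_comm, pow_mul]; norm_num
  calc (-1 : ℤ) ^ a * ((2 * k).choose a : ℤ) * ((-1) ^ a * ((2 * k).choose a : ℤ)) *
        ((-1) ^ a * ((2 * k).choose a : ℤ))
      = ((-1 : ℤ) ^ a) ^ 3 * ((2 * k).choose a : ℤ) ^ 3 := by ring
    _ = (-1) ^ a * ((2 * k).choose a : ℤ) ^ 3 := by rw [hcube]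

/-- The `B`-letter monomial `∏_ℓ x_{ℓ,B}^{e_ℓ}` with exponents `(p, q, r)`. [folklore] -/
def monB (p q r : ℕ) : (Fin 3 × Fin 3) →₀ ℕ := p • sx 0 2 + q • sx 1 2 + r • sx 2 2

/-- Coordinates of the `B`-letter monomial at `B`-letters. [folklore] -/
theorem monB_apply_two (p q r : ℕ) (ℓ : Fin 3) :
    monB p q r (ℓ, 2) = if ℓ = 0 then p else if ℓ = 1 then q else r := by
  simp only [monB, sx, Finsupp.coe_add, Finsupp.coe_smul, Pi.add_apply, Pi.smul_apply,
    Finsupp.single_apply, Prod.mk.injEq, smul_eq_mul]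
  fin_cases ℓ <;> simp

/-- The diagonal `B`-letter monomial is the `B` part of the target. [folklore] -/
theorem monB_eq_blockTgtB (k : ℕ) : monB k k k = blockTgtB k := by
  simp only [monB, blockTgtB, sx, Fin.sum_univ_three, Finsupp.smul_single, smul_eq_mul, mul_one]

/-- The `(p,q,r)` term of the trinomial expansion of `det^{3k}`, with the `B`-letters pulled out.
[folklore] -/
theorem trinomial_term_eq (p q r : ℕ) :
    (X (0, 2) * delta 1 2) ^ p * (-(X (1, 2) * delta 0 2)) ^ q * (X (2, 2) * delta 0 1) ^ r =
      monomial (monB p q r) 1 * ((-1) ^ q * (delta 1 2 ^ p * delta 0 2 ^ q * delta 0 1 ^ r)) := by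
  have hm : (monomial (monB p q r) (1 : ℤ) : BlockRing) = X (0, 2) ^ p * X (1, 2) ^ q * X (2, 2) ^ r := by
    rw [X_pow_eq_monomial, X_pow_eq_monomial, X_pow_eq_monomial, monomial_mul, monomial_mul]
    simp only [monB, sx, Finsupp.smul_single, smul_eq_mul, mul_one]
  rw [hm, neg_pow, mul_pow, mul_pow, mul_pow]
  ring

/-- **The coefficient of the target in the generating polynomial is `(-1)^k C(3k,k) C(2k,k) E(k)`.**
[folklore] -/
theorem coeff_blockTgt_detPow_mul (k : ℕ) :
    coeff (blockTgt k) (xMat.det ^ (3 * k) * (delta 0 1 * delta 0 2 * delta 1 2) ^ k) =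
      (-1) ^ k * (((3 * k).choose k * (2 * k).choose k : ℕ) : ℤ) *
        ∑ a ∈ Finset.range (2 * k + 1), (-1 : ℤ) ^ a * ((2 * k).choose a : ℤ) ^ 3 := by
  rw [det_xMat_eq, show X (0, 2) * delta 1 2 - X (1, 2) * delta 0 2 + X (2, 2) * delta 0 1 =
      X (0, 2) * delta 1 2 + (-(X (1, 2) * delta 0 2) + X (2, 2) * delta 0 1) by ring]
  rw [add_pow, Finset.sum_mul, coeff_sum]
  -- the inner binomial
  have hinner : ∀ p ∈ Finset.range (3 * k + 1),
      coeff (blockTgt k) ((X (0, 2) * delta 1 2) ^ p *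
        (-(X (1, 2) * delta 0 2) + X (2, 2) * delta 0 1) ^ (3 * k - p) * ((3 * k).choose p : BlockRing) *
          (delta 0 1 * delta 0 2 * delta 1 2) ^ k) =
        ∑ q ∈ Finset.range (3 * k - p + 1),
          if p = k ∧ q = k then
            (-1) ^ k * (((3 * k).choose k * (2 * k).choose k : ℕ) : ℤ) *
              ∑ a ∈ Finset.range (2 * k + 1), (-1 : ℤ) ^ a * ((2 * k).choose a : ℤ) ^ 3
          else 0 := by
    intro p hp
    rw [Finset.mem_range] at hp
    rw [add_pow, Finset.mul_sum, Finset.sum_mul, Finset.sum_mul, coeff_sum]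
    refine Finset.sum_congr rfl fun q hq => ?_
    rw [Finset.mem_range] at hq
    have hrw : (X (0, 2) * delta 1 2) ^ p *
        ((-(X (1, 2) * delta 0 2)) ^ q * (X (2, 2) * delta 0 1) ^ (3 * k - p - q) *
          ((3 * k - p).choose q : BlockRing)) * ((3 * k).choose p : BlockRing) *
          (delta 0 1 * delta 0 2 * delta 1 2) ^ k =
        monomial (monB p q (3 * k - p - q)) 1 *
          (C (((3 * k).choose p * (3 * k - p).choose q : ℕ) : ℤ) *
            ((-1) ^ q * (delta 1 2 ^ p * delta 0 2 ^ q * delta 0 1 ^ (3 * k - p - q) *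
              (delta 0 1 * delta 0 2 * delta 1 2) ^ k))) := by
      have h := trinomial_term_eq p q (3 * k - p - q)
      rw [show (((3 * k).choose p * (3 * k - p).choose q : ℕ) : ℤ) =
          ((3 * k).choose p : ℤ) * ((3 * k - p).choose q : ℤ) by push_cast; ring, map_mul,
        show (C ((3 * k).choose p : ℤ) : BlockRing) = ((3 * k).choose p : BlockRing) by simp,
        show (C ((3 * k - p).choose q : ℤ) : BlockRing) = ((3 * k - p).choose q : BlockRing) by simp]
      calc _ = ((X (0, 2) * delta 1 2) ^ p * (-(X (1, 2) * delta 0 2)) ^ q *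
            (X (2, 2) * delta 0 1) ^ (3 * k - p - q)) * (((3 * k - p).choose q : BlockRing) *
            ((3 * k).choose p : BlockRing) * (delta 0 1 * delta 0 2 * delta 1 2) ^ k) := by ring
        _ = _ := by rw [h]; ring
    rw [hrw, coeff_monomial_mul']
    by_cases hpq : p = k ∧ q = k
    · rw [if_pos hpq, hpq.1, hpq.2, show 3 * k - k - k = k by omega, monB_eq_blockTgtB, blockTgt_eq,
        if_pos le_add_self, add_tsub_cancel_right, one_mul, coeff_C_mul,
        show ((-1 : BlockRing)) ^ k = C ((-1 : ℤ) ^ k) by simp, coeff_C_mul]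
      have hpoly : delta 1 2 ^ k * delta 0 2 ^ k * delta 0 1 ^ k * (delta 0 1 * delta 0 2 * delta 1 2) ^ k =
          delta 0 1 ^ (2 * k) * delta 0 2 ^ (2 * k) * delta 1 2 ^ (2 * k) := by ring
      rw [hpoly, coeff_delta_prod_pow, show 3 * k - k = 2 * k by omega]
      ring
    · rw [if_neg hpq]
      rw [if_neg]
      intro hle
      apply hpq
      have h0 := hle ((0 : Fin 3), (2 : Fin 3))
      have h1 := hle ((1 : Fin 3), (2 : Fin 3))
      have h2 := hle ((2 : Fin 3), (2 : Fin 3))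
      rw [monB_apply_two, blockTgt_apply_two] at h0 h1 h2
      simp at h0 h1 h2
      omega
  rw [Finset.sum_congr rfl hinner]
  -- collapse the double sum
  rw [Finset.sum_congr rfl fun p hp => by
    exact (show (∑ q ∈ Finset.range (3 * k - p + 1),
        (if p = k ∧ q = k then
          (-1) ^ k * (((3 * k).choose k * (2 * k).choose k : ℕ) : ℤ) *
            ∑ a ∈ Finset.range (2 * k + 1), (-1 : ℤ) ^ a * ((2 * k).choose a : ℤ) ^ 3
        else 0)) =
        if p = k then (-1) ^ k * (((3 * k).choose k * (2 * k).choose k : ℕ) : ℤ) *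
            ∑ a ∈ Finset.range (2 * k + 1), (-1 : ℤ) ^ a * ((2 * k).choose a : ℤ) ^ 3 else 0 from by
      by_cases hpk : p = k
      · subst hpk
        simp only [true_and, if_true]
        rw [Finset.sum_ite_eq' (Finset.range (3 * p - p + 1)) p, if_pos (Finset.mem_range.mpr (by omega))]
      · simp [hpk])]
  rw [Finset.sum_ite_eq' (Finset.range (3 * k + 1)) k, if_pos (Finset.mem_range.mpr (by omega))]

/-- **The block signed count**: `blockSum k = (-1)^k · C(3k,k) C(2k,k) · Σ_a (-1)^a C(2k,a)^3`.
[folklore] -/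
theorem blockSum_eq (k : ℕ) :
    blockSum k = (-1) ^ k * (((3 * k).choose k * (2 * k).choose k : ℕ) : ℤ) *
      ∑ a ∈ Finset.range (2 * k + 1), (-1 : ℤ) ^ a * ((2 * k).choose a : ℤ) ^ 3 := by
  rw [← coeff_blockGen, blockGen_eq, coeff_blockTgt_detPow_mul]

/-- **The block signed count does not vanish at powers of two**: `blockSum (2^t) ≠ 0`
(`dixonSum_two_pow_ne_zero`; by Dixon's identity it is `((3k)!/(k!)^3)^2 > 0` for every `k`, not
needed here). [folklore] -/
theorem blockSum_two_pow_ne_zero (t : ℕ) : blockSum (2 ^ t) ≠ 0 := by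
  rw [blockSum_eq]
  refine mul_ne_zero (mul_ne_zero ?_ ?_) (dixonSum_two_pow_ne_zero t)
  · exact pow_ne_zero _ (by norm_num)
  · exact_mod_cast (Nat.mul_ne_zero (Nat.choose_pos (by omega)).ne' (Nat.choose_pos (by omega)).ne')

end

end Summit.ValiantsHypothesis.ValiantsHypothesis.Theorems.GeneratorObstructions.PowGenDegreeQP
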